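import Summits.KontsevichZagierPeriods.KontsevichZagierPeriods.Theorems.EllipticMomentKernel.Negative.ModelCurve
import Literature.NumberTheory.Transcendental.KZSubcalculusInvariants

/-!
# `EllipticMomentKernel` (stmt-KontsevichZagierPeriods-10631) — negative knowledge, part 4: a proved kernel element and two refuted sub-calculus strengthenings

On the model curve `y² = 4x³ − 4x`: the Hermite relation `3J₂ = J₀` PROVED by Newton–Leibniz on the
closed interval through the branch point (`integral_hermiteForm`, primitive `√f/2`), i.e.
`eval_hermiteElem : eval (3[σ, x²/√f] − [σ, 1/√f]) = 0`; `crux_predicts_hermiteElem`; and the two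
refuted strengthenings `not_kernelClaimByAdditivity_four_zero` (invariant: the tree's
`KZ.restrictedEval` at the window `{x < −1/2}`) and `not_kernelClaimByReparametrisation_four_zero`
(invariant: `KZ.coeffSum = 2`), with their `∀ (q₂,q₃)` forms. Every derivation of this kernel
element uses an additivity move AND a move of type (2) or (3). [folklore]
-/

noncomputable section

open MeasureTheory Set
open scoped BigOperators

namespace Summit.KontsevichZagierPeriods.HermiteRigidity.EllipticMomentKernelNegative

open Literature.NumberTheory.Transcendental
open Literature.NumberTheory.Transcendental.KZ
open Summit.KontsevichZagierPeriods.KontsevichZagierPeriods.Theses.HermiteRigidity (EllipticMomentKernel)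

section ModelCurve

open Literature.ModelTheory.ExponentialFields (IsSemialgebraic isSemialgebraic_setOf_eval_pos)
open MvPolynomial (aeval X C)

/-! ### The Hermite relation `3J₂ = J₀` on the model curve, PROVED: `(3x² − 1)/√f = d/dx (√f/2)` -/

/-- Derivative of the model cubic. [folklore] -/
theorem hasDerivAt_cubic (x : ℝ) : HasDerivAt (cubic 4 0) (12 * x ^ 2 - 4) x := by
  have h : cubic 4 0 = fun x : ℝ => 4 * x ^ 3 - 4 * x := funext cubic_four_zero
  rw [h]
  have h1 : HasDerivAt (fun x : ℝ => 4 * x ^ 3) (4 * (3 * x ^ 2)) x := by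
    simpa using (hasDerivAt_pow 3 x).const_mul 4
  have h2 : HasDerivAt (fun x : ℝ => 4 * x) (4 * 1) x := (hasDerivAt_id x).const_mul 4
  have h3 : HasDerivAt (fun y : ℝ => 4 * y ^ 3 - 4 * y) (4 * (3 * x ^ 2) - 4 * 1) x := h1.sub h2
  exact h3.congr_deriv (by ring)

/-- `√f/2` is a primitive of the Hermite exact form `(3x² − 1)/√f` on `(−1, 0)`. [folklore] -/
theorem hasDerivAt_half_sqrt_cubic {x : ℝ} (hx : x ∈ Ioo (-1 : ℝ) 0) :
    HasDerivAt (fun x => Real.sqrt (cubic 4 0 x) / 2)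
      ((3 * x ^ 2 - 1) / Real.sqrt (cubic 4 0 x)) x := by
  have hf : 0 < cubic 4 0 x := cubic_pos hx
  have h := ((hasDerivAt_cubic x).sqrt hf.ne').div_const 2
  refine h.congr_deriv ?_
  have hs : Real.sqrt (cubic 4 0 x) ≠ 0 := (Real.sqrt_pos.2 hf).ne'
  field_simp
  ring

/-- The Hermite exact form is integrable on `(−1, 0)`. [folklore] -/
theorem integrableOn_hermiteForm :
    IntegrableOn (fun x : ℝ => (3 * x ^ 2 - 1) / Real.sqrt (cubic 4 0 x)) (Ioo (-1 : ℝ) 0) := by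
  have h2 : IntegrableOn ((fun x : ℝ => 3 * (x ^ 2 / Real.sqrt (cubic 4 0 x))) -
      fun x => x ^ 0 / Real.sqrt (cubic 4 0 x)) (Ioo (-1 : ℝ) 0) :=
    ((integrableOn_genIntegrand 2).const_mul 3).sub (integrableOn_genIntegrand 0)
  refine h2.congr_fun (fun x _ => ?_) measurableSet_Ioo
  simp only [Pi.sub_apply, pow_zero]
  ring

/-- **Newton–Leibniz across the branch point** (the planner's "why it might fail", settled on the
model): for `−1 ≤ w ≤ 0`, `∫_{-1}^{w} (3x² − 1) dx/√f = √f(w)/2`, the primitive `√f/2` being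
continuous on the CLOSED interval and vanishing at the root `−1`; in particular (`w = 0`)
`3J₂ − J₀ = 0`. [cite: BostanLairezSalvy2013, §1 (Hermite reduction)] -/
theorem integral_hermiteForm {w : ℝ} (hw1 : -1 ≤ w) (hw0 : w ≤ 0) :
    ∫ x in (-1 : ℝ)..w, (3 * x ^ 2 - 1) / Real.sqrt (cubic 4 0 x) =
      Real.sqrt (cubic 4 0 w) / 2 := by
  have hcont : ContinuousOn (fun x => Real.sqrt (cubic 4 0 x) / 2) (Icc (-1 : ℝ) w) :=
    ((Real.continuous_sqrt.comp continuous_cubic).div_const 2).continuousOn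
  have hderiv : ∀ x ∈ Ioo (-1 : ℝ) w, HasDerivAt (fun x => Real.sqrt (cubic 4 0 x) / 2)
      ((3 * x ^ 2 - 1) / Real.sqrt (cubic 4 0 x)) x :=
    fun x hx => hasDerivAt_half_sqrt_cubic ⟨hx.1, lt_of_lt_of_le hx.2 hw0⟩
  have hint : IntervalIntegrable (fun x : ℝ => (3 * x ^ 2 - 1) / Real.sqrt (cubic 4 0 x))
      volume (-1) w :=
    (intervalIntegrable_iff_integrableOn_Ioo_of_le hw1).2
      (integrableOn_hermiteForm.mono_set (Ioo_subset_Ioo_right hw0))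
  rw [intervalIntegral.integral_eq_sub_of_hasDerivAt_of_le hw1 hcont hderiv hint]
  have : cubic 4 0 (-1) = 0 := by rw [cubic_four_zero]; norm_num
  simp [this]

/-- `3·∫ x²/√f − ∫ 1/√f = ∫ (3x² − 1)/√f` over `(−1, w)`. [folklore] -/
theorem three_mul_integral_sub {w : ℝ} (hw1 : -1 ≤ w) (hw0 : w ≤ 0) :
    3 * (∫ x in (-1 : ℝ)..w, x ^ 2 / Real.sqrt (cubic 4 0 x)) -
        ∫ x in (-1 : ℝ)..w, x ^ 0 / Real.sqrt (cubic 4 0 x) =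
      ∫ x in (-1 : ℝ)..w, (3 * x ^ 2 - 1) / Real.sqrt (cubic 4 0 x) := by
  have hI : ∀ m : ℕ, IntervalIntegrable (fun x : ℝ => x ^ m / Real.sqrt (cubic 4 0 x)) volume (-1) w :=
    fun m => (intervalIntegrable_iff_integrableOn_Ioo_of_le hw1).2
      ((integrableOn_genIntegrand m).mono_set (Ioo_subset_Ioo_right hw0))
  rw [← intervalIntegral.integral_const_mul, ← intervalIntegral.integral_sub ((hI 2).const_mul 3) (hI 0)]
  refine intervalIntegral.integral_congr fun x _ => ?_
  simp only [pow_zero]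
  ring

/-- **The Hermite element** `c₀ = 3[σ, x²/√f] − [σ, 1/√f]` of the model sector. [folklore] -/
def hermiteElem : FormalRep := 3 • KZ.of (genRep 2) - KZ.of (genRep 0)

/-- `c₀` is a `ℤ`-combination of sector generators. [folklore] -/
theorem hermiteElem_mem_closure : hermiteElem ∈ AddSubgroup.closure (gens 4 0) :=
  sub_mem (AddSubgroup.nsmul_mem _ (AddSubgroup.subset_closure (of_genRep_mem_gens 2)) 3)
    (AddSubgroup.subset_closure (of_genRep_mem_gens 0))

/-- **`c₀` has value `0`** (`3J₂ = J₀` on `y² = 4x³ − 4x`): a PROVED, non-trivial element of the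
kernel the crux talks about. [cite: BostanLairezSalvy2013, §1 (Hermite reduction)] -/
theorem eval_hermiteElem : KZ.eval hermiteElem = 0 := by
  simp only [hermiteElem, map_sub, map_nsmul, eval_of, value_genRep, nsmul_eq_mul, Nat.cast_ofNat]
  rw [three_mul_integral_sub (by norm_num) le_rfl, integral_hermiteForm (by norm_num) le_rfl]
  have : cubic 4 0 0 = 0 := by rw [cubic_four_zero]; norm_num
  simp [this]

/-- What the crux PREDICTS on the model curve: given rigidity of `(1, J₀, J₁)` for
`y² = 4x³ − 4x` (true: Chudnovsky 1976 / Masser, CM case `j = 1728`, `J₀ = Γ(1/4)²/(2√(2π))`;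
not provable in the tree today), `c₀` is a relation. It is one on paper — ONE Newton–Leibniz move
with primitive `√f/2` on the closed band `[−1, 0]` plus additivity bookkeeping (support item
`HermiteExactFormVanishes`, `P = 1`). [folklore] -/
theorem crux_predicts_hermiteElem (h : EllipticMomentKernel) (hR : Rigid 4 0) :
    hermiteElem ∈ KZ.relations :=
  ellipticMomentKernel_iff.mp h 4 0 (by rw [disc_four_zero]; norm_num) hR _
    hermiteElem_mem_closure eval_hermiteElem

/-! ### Refuted strengthening A: additivity moves alone do not generate the kernel -/

/-- The window `{all coordinates < −1/2}` (one per dimension). [folklore] -/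
def window (n : ℕ) : Set (Fin n → ℝ) := {p | ∀ i, p i < -(1 / 2 : ℝ)}

/-- The windows are measurable. [folklore] -/
theorem measurableSet_window (n : ℕ) : MeasurableSet (window n) := by
  have : window n = ⋂ i, {p : Fin n → ℝ | p i < -(1 / 2 : ℝ)} := by
    ext p; simp [window]
  rw [this]
  exact MeasurableSet.iInter fun i => measurableSet_lt (measurable_pi_apply i) measurable_const

/-- The window in dimension `1`. [folklore] -/
theorem window_one : window 1 = {p : Fin 1 → ℝ | p 0 < -(1 / 2 : ℝ)} := by
  ext p; simp [window, Fin.forall_fin_one]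

/-- Restricted value of a generator over the window. [folklore] -/
theorem restrictedEval_genRep (m : ℕ) :
    restrictedEval window (KZ.of (genRep m)) =
      ∫ x in (-1 : ℝ)..(-(1 / 2)), x ^ m / Real.sqrt (cubic 4 0 x) := by
  rw [restrictedEval_of, window_one, setIntegral_genRep_inter m (by norm_num) (by norm_num)]

/-- **The restricted value of `c₀` over the window is `√f(−1/2)/2 = √6/8 ≠ 0`.** [folklore] -/
theorem restrictedEval_hermiteElem :
    restrictedEval window hermiteElem = Real.sqrt (cubic 4 0 (-(1 / 2))) / 2 := by
  simp only [hermiteElem, map_sub, map_nsmul, restrictedEval_genRep, nsmul_eq_mul, Nat.cast_ofNat]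
  rw [three_mul_integral_sub (by norm_num) (by norm_num), integral_hermiteForm (by norm_num) (by norm_num)]

/-- Positivity of that restricted value. [folklore] -/
theorem restrictedEval_hermiteElem_pos : 0 < restrictedEval window hermiteElem := by
  rw [restrictedEval_hermiteElem]
  have : 0 < cubic 4 0 (-(1 / 2)) := cubic_pos ⟨by norm_num, by norm_num⟩
  positivity

/-- **`c₀` is NOT derivable by the additivity moves (1a) + (1b) alone** (they preserve every
restricted evaluation, `KZ.closure_add_le_ker_restrictedEval`). Any derivation of this kernel
element uses a change of variables or a Newton–Leibniz move. [folklore] -/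
theorem hermiteElem_not_mem_closure_add :
    hermiteElem ∉ AddSubgroup.closure (domainAddRel ∪ integrandAddRel) := fun h =>
  restrictedEval_hermiteElem_pos.ne'
    ((AddMonoidHom.mem_ker).1 (closure_add_le_ker_restrictedEval window measurableSet_window h))

/-! ### Refuted strengthening B: reparametrisation + Newton–Leibniz alone do not either -/

/-- `c₀` has coefficient sum `2`. [folklore] -/
theorem coeffSum_hermiteElem : coeffSum hermiteElem = 2 := by
  simp [hermiteElem]

/-- **`c₀` is NOT derivable by moves (2) + (3) alone** (they preserve the coefficient sum,
`KZ.closure_cov_nl_le_ker_coeffSum`): an additivity move is necessary as well. [folklore] -/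
theorem hermiteElem_not_mem_closure_cov_nl :
    hermiteElem ∉ AddSubgroup.closure (changeOfVariablesRel ∪ newtonLeibnizRel) := fun h => by
  have h2 := (AddMonoidHom.mem_ker).1 (closure_cov_nl_le_ker_coeffSum h)
  rw [coeffSum_hermiteElem] at h2
  exact absurd h2 (by norm_num)

/-- Strengthening A of the kernel claim: additivity moves suffice. [folklore] -/
def KernelClaimByAdditivity (q₂ q₃ : ℚ) : Prop :=
  ∀ c ∈ AddSubgroup.closure (gens q₂ q₃), KZ.eval c = 0 →
    c ∈ AddSubgroup.closure (domainAddRel ∪ integrandAddRel)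

/-- Strengthening B of the kernel claim: moves (2) + (3) suffice. [folklore] -/
def KernelClaimByReparametrisation (q₂ q₃ : ℚ) : Prop :=
  ∀ c ∈ AddSubgroup.closure (gens q₂ q₃), KZ.eval c = 0 →
    c ∈ AddSubgroup.closure (changeOfVariablesRel ∪ newtonLeibnizRel)

/-- **Refutation of strengthening A on the model curve.** [folklore] -/
theorem not_kernelClaimByAdditivity_four_zero : ¬ KernelClaimByAdditivity 4 0 := fun h =>
  hermiteElem_not_mem_closure_add (h _ hermiteElem_mem_closure eval_hermiteElem)

/-- **Refutation of strengthening B on the model curve.** [folklore] -/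
theorem not_kernelClaimByReparametrisation_four_zero : ¬ KernelClaimByReparametrisation 4 0 :=
  fun h => hermiteElem_not_mem_closure_cov_nl (h _ hermiteElem_mem_closure eval_hermiteElem)

/-- The sub-calculus strengthening A of `EllipticMomentKernelWithoutRigidity` is false. [folklore] -/
theorem not_forall_kernelClaimByAdditivity :
    ¬ ∀ q₂ q₃ : ℚ, 0 < disc q₂ q₃ → KernelClaimByAdditivity q₂ q₃ := fun h =>
  not_kernelClaimByAdditivity_four_zero (h 4 0 (by rw [disc_four_zero]; norm_num))

/-- The sub-calculus strengthening B of `EllipticMomentKernelWithoutRigidity` is false. [folklore] -/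
theorem not_forall_kernelClaimByReparametrisation :
    ¬ ∀ q₂ q₃ : ℚ, 0 < disc q₂ q₃ → KernelClaimByReparametrisation q₂ q₃ := fun h =>
  not_kernelClaimByReparametrisation_four_zero (h 4 0 (by rw [disc_four_zero]; norm_num))

end ModelCurve

end Summit.KontsevichZagierPeriods.HermiteRigidity.EllipticMomentKernelNegative
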